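import Summits.BirchSwinnertonDyer.Rank1Residual.X1.GeneratorBoundOrd
import HarnessLib

/-!
# Keller–Yin Lemma 5.1.2 IN THE KERNEL: the finite-submodule bound `p^a · char(X) ⊆ Fitt₀(X)` for a
# finitely generated torsion `Λ`-module (road H of crux 4 `BSDpOnCellC`, stmt-BirchSwinnertonDyer-19034,
# line b1 stub `stub_c3`; cell `bsd-eis`, seat `bsd-eis-c3h` g0)

HONEST FRAMING (cell `bsd-eis`, run/shared/lean/pub/bsd-eis/): THEOREMS ONLY (pure commutative algebra);
nothing booked; X2 stays CONSTRUCTION-SHAPED; no label or count moves.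

## Why

Road H's typed inputs over the wide receptacle, `X2.HidaLimitInputsIntAt W p` (cgshw g8, p431128),
carry for every generator `F` of `Ch_Λ(X_ac^∅)` the conjunct

  `∃ a, (p)^a · (F) ⊆ Fitt_Λ(X_ac^∅)`      [Keller–Yin arXiv:2402.12781v2 Lemma 5.1.2's finite-submodule bound]

"kept as input like K4 (provable structure theory)" (cgshw MEMO-10 §3 D2). This file PROVES it for every
finitely generated TORSION `Λ = ℤ_p⟦T⟧`-module `X` (`exists_span_C_pow_mul_span_le_fittingIdeal_zero`), so
that conjunct FOLLOWS from "`X_ac^∅` is `Λ`-torsion" (conversely it forces torsion: `Fitt₀ ⊆ Ann`), and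
road H's typed inputs shrink to [torsion] ∧ [member data] (companion file
`Theorems/EisensteinPrimesBSDpOnCellCStubC3RoadH.lean`).

## Contents (all proved; no `def`, no instance, no notation)

* §1 (any commutative ring) **`fittingIdeal_zero_mul_quotient_le`**: for a submodule `A ≤ B`,
  `Fitt₀(A) · Fitt₀(B/A) ⊆ Fitt₀(B)` (Stacks 07ZA (3) at `k = l = 0`; Eisenbud §20.2): lift generators and
  relations of `B/A`, correct the lifted relations by elements of `A`, and the relation matrix of the
  concatenated family is block lower-triangular with determinant `det ρ_A · det ρ_C`.
* §2 (Noetherian modules) **`exists_finite_submodule_forall_finite_eq_bot`**: a maximal finite submodule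
  `N ≤ X` exists and `X/N` has no non-zero finite submodule.
* §3 (`Λ = ℤ_p⟦T⟧`) **`charIdeal_eq_top_of_finite`** (finite ⟹ pseudo-null ⟹ all height-one local lengths
  vanish), **`exists_C_p_pow_mem_fittingIdeal_zero_of_finite`** (`p^{k·g} ∈ Fitt₀(N)` for a finite `N`
  with `g` generators killed by `p^k`), and the target
  **`exists_span_C_pow_mul_span_le_fittingIdeal_zero`**: `X` f.g. torsion, `char(X) = (F)` ⟹
  `∃ a, (p)^a·(F) ⊆ Fitt₀(X)` — by §2, `char(X) = char(N)·char(X/N) = char(X/N) = Fitt₀(X/N)` (the tree's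
  `X1.GeneratorBoundOrd.charIdeal_eq_fittingIdeal_zero` for modules without finite submodules, Skinner–Urban
  §3.1.6) and §1.

References: The Stacks Project, Tag 07ZA; D. Eisenbud, GTM 150, §20.2; L. Washington, GTM 83, §13.2;
NSW, Cohomology of Number Fields, (5.1.4), (5.3.9); C. Skinner–E. Urban, Invent. Math. 195 (2014) §3.1.6;
Keller–Yin arXiv:2402.12781v2 Lemma 5.1.2 (the statement discharged; PRE — nothing of KY is used).
-/

set_option autoImplicit false
set_option linter.dupNamespace false

noncomputable section

open scoped Classical

open Literature.RingTheory.FittingIdeal PowerSeries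
  Literature.NumberTheory.EllipticCurves Literature.NumberTheory.EllipticCurves.IwasawaAlgebra

namespace Summit.BirchSwinnertonDyer.BirchSwinnertonDyer.Theorems

/-! ### §1 Fitting ideals of an extension: `Fitt₀(A) · Fitt₀(B/A) ⊆ Fitt₀(B)` -/

section Extension

universe u v

variable {R : Type u} [CommRing R] {B : Type v} [AddCommGroup B] [Module R B] (A : Submodule R B)

/-- **Block step.** For a generating family `xA` of `A` with relations `ρA` and column choice `σA`, and a
generating family `z` of `B ⧸ A` with relations `ρC` and column choice `σC`, the product of the two
relation determinants lies in `Fitt₀(B)`: the concatenation of `xA` and lifts of `z` generates `B`, the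
relations of `A` padded by zeros and the lifted relations of `B ⧸ A` corrected by elements of `A` are
relations among it, and their matrix on the concatenated columns is block lower-triangular.
[cite: Eisenbud1995, §20.2] -/
theorem det_mul_det_mem_fittingIdeal_zero {jA jC : ℕ} (xA : Fin (jA + 0) → A)
    (hxA : Submodule.span R (Set.range xA) = ⊤) (ρA : Fin jA → Fin (jA + 0) → R)
    (hρA : ∀ i, ∑ l, ρA i l • xA l = 0) (σA : Fin jA → Fin (jA + 0)) (z : Fin (jC + 0) → B ⧸ A)
    (hz : Submodule.span R (Set.range z) = ⊤) (ρC : Fin jC → Fin (jC + 0) → R)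
    (hρC : ∀ i, ∑ l, ρC i l • z l = 0) (σC : Fin jC → Fin (jC + 0)) :
    Matrix.det (Matrix.of fun i i' => ρA i (σA i')) * Matrix.det (Matrix.of fun i i' => ρC i (σC i')) ∈
      Module.fittingIdeal R B 0 := by
  -- lifts of the generators of `B ⧸ A`
  choose zl hzl using fun k => A.mkQ_surjective (z k)
  -- the lifted relations land in `A = span xA`: correct them
  have hmemA : ∀ i, ∑ l, ρC i l • zl l ∈ A := fun i => by
    rw [← Submodule.ker_mkQ A, LinearMap.mem_ker, map_sum]
    simp_rw [map_smul, Submodule.mkQ_apply]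
    have : ∀ l, Submodule.Quotient.mk (p := A) (zl l) = z l := fun l => hzl l
    simp_rw [this]
    exact hρC i
  have hτ : ∀ i, ∃ τ : Fin (jA + 0) → R, ∑ l, τ l • (xA l : B) = ∑ l, ρC i l • zl l := fun i => by
    have hmem : (⟨_, hmemA i⟩ : A) ∈ Submodule.span R (Set.range xA) := by rw [hxA]; trivial
    obtain ⟨τ, hτ⟩ := (Submodule.mem_span_range_iff_exists_fun R).1 hmem
    refine ⟨τ, ?_⟩
    have := congrArg (fun a : A => (a : B)) hτ
    simpa using this
  choose τ hτ using hτ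
  -- the concatenated family generates `B`
  set y : Fin ((jA + 0) + (jC + 0)) → B := Fin.append (fun l => (xA l : B)) zl with hy_def
  have hy : Submodule.span R (Set.range y) = ⊤ := by
    rw [Submodule.eq_top_iff']
    intro b
    have hb : A.mkQ b ∈ Submodule.span R (Set.range z) := by rw [hz]; trivial
    obtain ⟨c, hc⟩ := (Submodule.mem_span_range_iff_exists_fun R).1 hb
    have hdiff : b - ∑ k, c k • zl k ∈ A := by
      rw [← Submodule.ker_mkQ A, LinearMap.mem_ker, map_sub, map_sum]
      simp_rw [map_smul, Submodule.mkQ_apply]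
      have : ∀ l, Submodule.Quotient.mk (p := A) (zl l) = z l := fun l => hzl l
      simp_rw [this, hc]
      exact sub_self _
    have hmem : (⟨_, hdiff⟩ : A) ∈ Submodule.span R (Set.range xA) := by rw [hxA]; trivial
    obtain ⟨d, hd⟩ := (Submodule.mem_span_range_iff_exists_fun R).1 hmem
    have hd' : ∑ l, d l • (xA l : B) = b - ∑ k, c k • zl k := by
      have := congrArg (fun a : A => (a : B)) hd
      simpa using this
    have hb' : b = ∑ l, d l • y (Fin.castAdd (jC + 0) l) + ∑ k, c k • y (Fin.natAdd (jA + 0) k) := by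
      simp only [hy_def, Fin.append_left, Fin.append_right, hd']
      abel
    rw [hb']
    refine Submodule.add_mem _ (Submodule.sum_mem _ fun l _ => Submodule.smul_mem _ _ ?_)
      (Submodule.sum_mem _ fun k _ => Submodule.smul_mem _ _ ?_)
    · exact Submodule.subset_span ⟨_, rfl⟩
    · exact Submodule.subset_span ⟨_, rfl⟩
  -- the block relations and block columns
  let ρ : Fin (jA + jC) → Fin ((jA + 0) + (jC + 0)) → R :=
    Fin.append (fun i => Fin.append (ρA i) (0 : Fin (jC + 0) → R))
      (fun k => Fin.append (-(τ k)) (ρC k))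
  let σ : Fin (jA + jC) → Fin ((jA + 0) + (jC + 0)) :=
    Fin.append (fun i' => Fin.castAdd (jC + 0) (σA i')) (fun k' => Fin.natAdd (jA + 0) (σC k'))
  have hρ : ∀ I, ∑ L, ρ I L • y L = 0 := by
    intro I
    rw [Fin.sum_univ_add]
    refine Fin.addCases (fun i => ?_) (fun k => ?_) I
    · simp only [ρ, hy_def, Fin.append_left, Fin.append_right, Pi.zero_apply, zero_smul,
        Finset.sum_const_zero, add_zero]
      have := congrArg (fun a : A => (a : B)) (hρA i)
      simpa using this
    · simp only [ρ, hy_def, Fin.append_left, Fin.append_right, Pi.neg_apply, neg_smul,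
        Finset.sum_neg_distrib, hτ k]
      exact neg_add_cancel _
  have hmem := Module.det_mem_relMinorIdeal y ρ hρ σ
  -- the block determinant
  have hM : (Matrix.of fun I I' => ρ I (σ I')) =
      Matrix.reindex finSumFinEquiv finSumFinEquiv
        (Matrix.fromBlocks (Matrix.of fun i i' => ρA i (σA i')) 0
          (Matrix.of fun k i' => -(τ k (σA i'))) (Matrix.of fun k k' => ρC k (σC k'))) := by
    ext I I'
    obtain ⟨s, rfl⟩ := finSumFinEquiv.surjective I
    obtain ⟨t, rfl⟩ := finSumFinEquiv.surjective I'
    simp only [Matrix.reindex_apply, Matrix.submatrix_apply, Equiv.symm_apply_apply, Matrix.of_apply]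
    rcases s with i | k <;> rcases t with i' | k' <;>
      simp [ρ, σ, finSumFinEquiv_apply_left, finSumFinEquiv_apply_right, Fin.append_left,
        Fin.append_right, Matrix.fromBlocks_apply₁₁, Matrix.fromBlocks_apply₁₂,
        Matrix.fromBlocks_apply₂₁, Matrix.fromBlocks_apply₂₂]
  rw [hM, Matrix.det_reindex_self, Matrix.det_fromBlocks_zero₁₂] at hmem
  exact Module.relMinorIdeal_le_fittingIdeal (j := jA + jC) (k := 0) y hy hmem

/-- **`Fitt₀(A) · Fitt₀(B ⧸ A) ⊆ Fitt₀(B)`** for a submodule `A ≤ B` over any commutative ring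
(The Stacks Project, Tag 07ZA (3) with `k = l = 0`; Eisenbud, GTM 150, §20.2). Both Fitting ideals are
reduced to their generating relation minors (`Module.fittingIdeal_le_of_forall_relMinorIdeal_le`,
`Module.relMinorIdeal_le_iff`) and the block step `det_mul_det_mem_fittingIdeal_zero` concludes.
[cite: Eisenbud1995, §20.2] -/
theorem fittingIdeal_zero_mul_quotient_le :
    Module.fittingIdeal R A 0 * Module.fittingIdeal R (B ⧸ A) 0 ≤ Module.fittingIdeal R B 0 := by
  rw [Submodule.mul_le]
  intro m hm n hn
  have h1 : Module.fittingIdeal R (B ⧸ A) 0 ≤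
      Submodule.comap (LinearMap.mulLeft R m) (Module.fittingIdeal R B 0) := by
    refine Module.fittingIdeal_le_of_forall_relMinorIdeal_le fun jC z hz => ?_
    rw [Module.relMinorIdeal_le_iff]
    intro ρC σC hρC
    rw [Submodule.mem_comap, LinearMap.mulLeft_apply]
    have h2 : Module.fittingIdeal R A 0 ≤ Submodule.comap
        (LinearMap.mulRight R (Matrix.det (Matrix.of fun i i' => ρC i (σC i'))))
        (Module.fittingIdeal R B 0) := by
      refine Module.fittingIdeal_le_of_forall_relMinorIdeal_le fun jA xA hxA => ?_
      rw [Module.relMinorIdeal_le_iff]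
      intro ρA σA hρA
      rw [Submodule.mem_comap, LinearMap.mulRight_apply]
      exact det_mul_det_mem_fittingIdeal_zero A xA hxA ρA hρA σA z hz ρC hρC σC
    exact h2 hm
  exact h1 hn


end Extension

/-! ### §2 The maximal finite submodule of a Noetherian module -/

section MaximalFinite

universe u v

variable {R : Type u} [Ring R] {X : Type v} [AddCommGroup X] [Module R X]

/-- An extension of a finite module by a finite submodule is finite: if `N ≤ P'` are submodules with
`N` finite and the image of `P'` in `X ⧸ N` finite, then `P'` is finite. [folklore] -/
theorem finite_of_le_of_finite_map_mkQ {N P' : Submodule R X} (hle : N ≤ P') [Finite N]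
    (hfin : Finite (Submodule.map N.mkQ P')) : Finite P' := by
  let φ : P' →ₗ[R] X ⧸ N := N.mkQ.domRestrict P'
  have hker : LinearMap.ker φ = Submodule.comap P'.subtype N := by
    rw [LinearMap.ker_domRestrict, Submodule.ker_mkQ]
  have hrange : LinearMap.range φ = Submodule.map N.mkQ P' := by
    rw [LinearMap.range_domRestrict]
  haveI hK : Finite (LinearMap.ker φ) := by
    rw [hker]
    exact Finite.of_equiv N (Submodule.comapSubtypeEquivOfLe hle).symm.toEquiv
  haveI hQ : Finite (P' ⧸ LinearMap.ker φ) := by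
    haveI : Finite (LinearMap.range φ) := by rw [hrange]; exact hfin
    exact Finite.of_equiv _ φ.quotKerEquivRange.symm.toEquiv
  exact @Finite.of_addSubgroup_quotient P' _ (LinearMap.ker φ).toAddSubgroup hK hQ

/-- **Maximal finite submodule.** A Noetherian module `X` has a finite submodule `N` such that `X ⧸ N`
has no non-zero finite submodule: take `N` maximal among the finite submodules (Noetherian
induction); a finite `P ≤ X ⧸ N` pulls back to a finite submodule containing `N`, hence equal to it.
(Washington §13.2 / NSW (5.3.9): the maximal finite submodule of a finitely generated `Λ`-module.)
[folklore] -/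
theorem exists_finite_submodule_forall_finite_eq_bot [IsNoetherian R X] :
    ∃ N : Submodule R X, Finite N ∧ ∀ P : Submodule R (X ⧸ N), Finite P → P = ⊥ := by
  obtain ⟨N, hN, hmax⟩ := set_has_maximal_iff_noetherian.mpr ‹IsNoetherian R X›
    {N : Submodule R X | Finite N} ⟨⊥, (inferInstance : Finite (⊥ : Submodule R X))⟩
  haveI : Finite N := hN
  refine ⟨N, hN, fun P hP => ?_⟩
  let P' : Submodule R X := Submodule.comap N.mkQ P
  have hle : N ≤ P' := by
    intro x hx
    rw [Submodule.mem_comap, Submodule.mkQ_apply, (Submodule.Quotient.mk_eq_zero N).2 hx]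
    exact P.zero_mem
  have hmap : Submodule.map N.mkQ P' = P := Submodule.map_comap_eq_of_surjective N.mkQ_surjective P
  have hP' : Finite P' := finite_of_le_of_finite_map_mkQ hle (by rw [hmap]; exact hP)
  have heq : P' = N := (eq_of_le_of_not_lt hle (hmax P' hP')).symm
  rw [← hmap, heq, Submodule.mkQ_map_self]

end MaximalFinite

/-! ### §3 Over `Λ = ℤ_p⟦T⟧`: the finite-submodule bound (Keller–Yin Lemma 5.1.2) -/

section Iwasawa

variable {p : ℕ} [Fact p.Prime]

/-- The characteristic ideal of a FINITE `Λ`-module is the unit ideal: a finite module is pseudo-null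
(`isPseudoNull_of_finite`), so every localisation at a height-one prime vanishes and every exponent in
`char = ∏_{ht 𝔭 = 1} 𝔭^{length}` is `0`. [cite: Washington1997, §13.2] -/
theorem charIdeal_eq_top_of_finite (N : Type*) [AddCommGroup N] [Module (IwasawaAlgebra p) N]
    [Finite N] : Module.charIdeal (IwasawaAlgebra p) N = ⊤ := by
  unfold Module.charIdeal
  rw [← Ideal.one_eq_top]
  refine finprod_mem_of_eqOn_one fun 𝔭 h𝔭 => ?_
  have hsub := isPseudoNull_of_finite p N 𝔭 (le_of_eq h𝔭)
  have h0 : Module.lengthAt (IwasawaAlgebra p) N 𝔭 = 0 := by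
    rw [Module.lengthAt, Module.length_eq_zero_iff]
    exact hsub
  simp [h0]

/-- A finite `Λ`-module is killed by a power of `p`, uniformly: pseudo-null modules are `p`-power
torsion elementwise (`exists_C_p_pow_smul_eq_zero_of_isPseudoNull`), and a finite module needs only
finitely many exponents. [cite: Washington1997, §13.2] -/
theorem exists_C_p_pow_smul_eq_zero_of_finite (N : Type*) [AddCommGroup N]
    [Module (IwasawaAlgebra p) N] [Finite N] :
    ∃ k : ℕ, ∀ z : N, (C (p : ℤ_[p]) : IwasawaAlgebra p) ^ k • z = 0 := by
  haveI := Fintype.ofFinite N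
  choose e he using fun z : N =>
    exists_C_p_pow_smul_eq_zero_of_isPseudoNull (p := p) (isPseudoNull_of_finite p N) z
  refine ⟨Finset.univ.sup e, fun z => ?_⟩
  have hle : e z ≤ Finset.univ.sup e := Finset.le_sup (Finset.mem_univ z)
  rw [← Nat.sub_add_cancel hle, pow_add, mul_smul, he z, smul_zero]

/-- **`p^{k·g} ∈ Fitt₀(N)` for a finite `Λ`-module `N`**: with `g` generators `x₁,…,x_g` and `p^k N = 0`
the diagonal relations `p^k xᵢ = 0` have determinant `p^{kg}`. [cite: Eisenbud1995, §20.2] -/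
theorem exists_C_p_pow_mem_fittingIdeal_zero_of_finite (N : Type*) [AddCommGroup N]
    [Module (IwasawaAlgebra p) N] [Module.Finite (IwasawaAlgebra p) N] [Finite N] :
    ∃ a : ℕ, (C (p : ℤ_[p]) : IwasawaAlgebra p) ^ a ∈ Module.fittingIdeal (IwasawaAlgebra p) N 0 := by
  obtain ⟨k, hk⟩ := exists_C_p_pow_smul_eq_zero_of_finite (p := p) N
  obtain ⟨g, x, hx⟩ := Module.Finite.exists_fin (R := IwasawaAlgebra p) (M := N)
  refine ⟨k * g, ?_⟩
  let ρ : Fin g → Fin (g + 0) → IwasawaAlgebra p :=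
    fun i l => Matrix.diagonal (fun _ : Fin g => (C (p : ℤ_[p]) : IwasawaAlgebra p) ^ k) i l
  have hρ : ∀ i, ∑ l, ρ i l • x l = 0 := fun i => by
    simp only [ρ, Matrix.diagonal_apply, ite_smul, zero_smul, Finset.sum_ite_eq, Finset.mem_univ,
      if_true]
    exact hk (x i)
  have hmem := Module.det_mem_fittingIdeal (k := 0) (j := g) x hx ρ hρ (Function.Embedding.refl _)
  have hM : (Matrix.of fun i i' => ρ i ((Function.Embedding.refl (Fin g)) i')) =
      Matrix.diagonal (fun _ : Fin g => (C (p : ℤ_[p]) : IwasawaAlgebra p) ^ k) := by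
    ext i j
    rfl
  rw [hM, Matrix.det_diagonal, Finset.prod_const, Finset.card_univ, Fintype.card_fin, ← pow_mul]
    at hmem
  exact hmem

/-- A quotient of a torsion module is torsion. [folklore] -/
theorem isTorsion_quotient {X : Type*} [AddCommGroup X] [Module (IwasawaAlgebra p) X]
    (hX : Module.IsTorsion (IwasawaAlgebra p) X) (N : Submodule (IwasawaAlgebra p) X) :
    Module.IsTorsion (IwasawaAlgebra p) (X ⧸ N) := fun y => by
  obtain ⟨x, rfl⟩ := N.mkQ_surjective y
  obtain ⟨a, ha⟩ := @hX x
  refine ⟨a, ?_⟩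
  rw [Submonoid.smul_def, ← map_smul, ← Submonoid.smul_def, ha, map_zero]

/-- **KELLER–YIN LEMMA 5.1.2 IN THE KERNEL (the finite-submodule bound).** For a finitely generated
TORSION `Λ = ℤ_p⟦T⟧`-module `X` and a generator `F` of its characteristic ideal there is `a : ℕ` with
`(p)^a · (F) ⊆ Fitt_Λ(X)` (`Fitt₀`). Proof: let `N ≤ X` be the maximal finite submodule (§2); then
`char(X) = char(N)·char(X/N) = char(X/N)` (multiplicativity `Module.charIdeal_eq_mul_of_exact`; `char(N) = Λ`),
`char(X/N) = Fitt₀(X/N)` since `X/N` has no non-zero finite submodule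
(`X1.GeneratorBoundOrd.charIdeal_eq_fittingIdeal_zero`, Skinner–Urban §3.1.6), `p^a ∈ Fitt₀(N)`, and
`Fitt₀(N)·Fitt₀(X/N) ⊆ Fitt₀(X)` (§1). This is the `∃ a` conjunct of road H's typed inputs
`X2.HidaLimitInputsIntAt` (p431128) for `X = X_ac^∅`; so that conjunct FOLLOWS from "`X_ac^∅` is
`Λ`-torsion" (and conversely forces it, since `Fitt₀ ⊆ Ann`). Pure algebra; nothing of Keller–Yin is used. [cite: Washington1997, §13.2 (structure of Λ-modules)]
[cite: SkinnerUrban2014, §3.1.6 (p. 20) (Fitting vs characteristic ideal)] [cite: Eisenbud1995, §20.2] -/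
theorem exists_span_C_pow_mul_span_le_fittingIdeal_zero (X : Type*) [AddCommGroup X]
    [Module (IwasawaAlgebra p) X] [Module.Finite (IwasawaAlgebra p) X]
    (hX : Module.IsTorsion (IwasawaAlgebra p) X) {F : IwasawaAlgebra p}
    (hF : Module.charIdeal (IwasawaAlgebra p) X = Ideal.span {F}) :
    ∃ a : ℕ, Ideal.span {(C (p : ℤ_[p]) : IwasawaAlgebra p)} ^ a * Ideal.span {F} ≤
      Module.fittingIdeal (IwasawaAlgebra p) X 0 := by
  haveI : IsNoetherian (IwasawaAlgebra p) X := isNoetherian_of_isNoetherianRing_of_finite _ _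
  obtain ⟨N, hNfin, hnf⟩ :=
    exists_finite_submodule_forall_finite_eq_bot (R := IwasawaAlgebra p) (X := X)
  haveI := hNfin
  haveI : Module.Finite (IwasawaAlgebra p) N := Module.Finite.iff_fg.mpr (IsNoetherian.noetherian N)
  have hY : Module.IsTorsion (IwasawaAlgebra p) (X ⧸ N) := isTorsion_quotient hX N
  have hcharY : Module.charIdeal (IwasawaAlgebra p) (X ⧸ N) =
      Module.fittingIdeal (IwasawaAlgebra p) (X ⧸ N) 0 :=
    Summit.BirchSwinnertonDyer.Rank1Residual.X1.GeneratorBoundOrd.charIdeal_eq_fittingIdeal_zero hY hnf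
  have hmul : Module.charIdeal (IwasawaAlgebra p) X =
      Module.charIdeal (IwasawaAlgebra p) N * Module.charIdeal (IwasawaAlgebra p) (X ⧸ N) :=
    Module.charIdeal_eq_mul_of_exact hX N.subtype N.mkQ (Submodule.injective_subtype N)
      (Submodule.mkQ_surjective N) (LinearMap.exact_subtype_mkQ N)
  rw [charIdeal_eq_top_of_finite (p := p) N, Ideal.top_mul, hcharY, hF] at hmul
  obtain ⟨a, ha⟩ := exists_C_p_pow_mem_fittingIdeal_zero_of_finite (p := p) N
  refine ⟨a, ?_⟩
  calc Ideal.span {(C (p : ℤ_[p]) : IwasawaAlgebra p)} ^ a * Ideal.span {F}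
      = Ideal.span {(C (p : ℤ_[p]) : IwasawaAlgebra p) ^ a} *
          Module.fittingIdeal (IwasawaAlgebra p) (X ⧸ N) 0 := by
        rw [Ideal.span_singleton_pow, hmul]
    _ ≤ Module.fittingIdeal (IwasawaAlgebra p) N 0 *
          Module.fittingIdeal (IwasawaAlgebra p) (X ⧸ N) 0 :=
        Ideal.mul_mono_left ((Ideal.span_singleton_le_iff_mem _).2 ha)
    _ ≤ Module.fittingIdeal (IwasawaAlgebra p) X 0 := fittingIdeal_zero_mul_quotient_le N

end Iwasawa

end Summit.BirchSwinnertonDyer.BirchSwinnertonDyer.Theorems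

end
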